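import Literature.NumberTheory.EllipticCurves.CPMuDescentK3BoxSplitTwoNodeKill
import HarnessLib

/-!
# The `α̂`-box over `ℚ(√−3)` CUT TWICE: two killing places (Cohen–Pazuki 2009, Thm. 2.1 with the local conditions at two primes of `s`)

Topic `NumberTheory/EllipticCurves`. Sequel of `CPMuDescentK3BoxSplitNodeKill` / `…SplitTwoNodeKill`. The residue relation at a node place is
factored out (`exists_sub_pow_three_mem_of_sha_nodePlace`: at a node place `w₀` of `Ê₃` every integral representative of a `Ш`-candidate is a
cube mod `w₀`; `three_dvd_exponent_of_certs`: with certificates `gᵢ ≡ ζ^{cᵢ} yᵢ³ (mod w₀)` the candidate `[ζ^i g₁^{k₁} g₂^{k₂}]` satisfies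
`3 ∣ i + c₁k₁ + c₂k₂`), and then applied at TWO places `w₀`, `w₁`:
* **`torsorClass_eq_zero_of_mem_sha_of_norm_cube_of_split_doubleKill`** — ONE split prime, two independent relations (`c₀ ≢ c₀' (mod 3)`):
  the box `⟨[ζ], [ϖϖ̄²]⟩` is killed entirely, NO `K3`-point needed;
* **`torsorClass_eq_zero_of_mem_sha_of_norm_cube_of_split₂_doubleKill`** — TWO split primes, two independent relations: the box
  `⟨[ζ], [ϖ₁ϖ̄₁²], [ϖ₂ϖ̄₂²]⟩` is cut to a line, ONE `K3`-point on it books the `K3` side.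
These are the `hbox` inputs of `CPMuDescentQBoxNodeKillBooking.forall_mem_sha_three_nsmul_eq_zero_of_QKill_of_box` for the last ten census curves
(`ℤ/6`, rank `2`, `N < 5·10⁵`) within reach of the `3`-isogeny descent. Theorems only; no definitions, no named facts.

## References
* [CohenPazuki2009] H. Cohen, F. Pazuki, *Elementary 3-descent with a 3-isogeny*, Acta Arith. 140 (2009), Def. 1.3, Thm. 2.1, Prop. 2.2.
* [SilvermanAEC2009] J. H. Silverman, *The Arithmetic of Elliptic Curves*, 2nd ed. (2009), Thm. X.4.2 (a), Prop. X.4.9.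
* [IrelandRosen1990] K. Ireland, M. Rosen, GTM 84, Ch. 9 §3 (cubic residue character).
-/

noncomputable section

open scoped Classical
open WeierstrassCurve IsDedekindDomain IsDedekindDomain.HeightOneSpectrum NumberField

namespace Literature.NumberTheory.EllipticCurves

namespace CPMuDescent

open MordellDescent ThreeTorsionDescent MuThreeKernel WithZero
open Literature.NumberTheory.NumberFields Literature.NumberTheory.NumberFields.K3

/-! ## The residue relation at a node place, factored -/

/-- **At a node place every integral representative of a `Ш`-candidate is a cube mod `w₀`.** For a Cohen–Pazuki pair over `K3`, `u` with
`[C_u] ∈ Ш`, `u = x·r³` with `x ∈ 𝓞 K3`, and a place `w₀` with `w₀(2) = w₀(3) = w₀(s₃) = 1 > w₀(27s₃ − 4m₃³)`: `x ≡ y³ (mod w₀)`.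
[cite: CohenPazuki2009, Theorem 2.1 (2)] [cite: SilvermanAEC2009, Prop. X.4.9] -/
theorem exists_sub_pow_three_mem_of_sha_nodePlace {a₃ b₃ t m₃ s₃ : K3} (hb₃ : b₃ ≠ 0) (hd₃ : 4 * a₃ ^ 3 + 9 * b₃ ≠ 0) (ht : t ≠ 0)
    (hm₃ : t * m₃ = 3 * a₃) (hs₃ : t ^ 3 * s₃ = 4 * a₃ ^ 3 + 9 * b₃)
    {u : K3} (hu : u ≠ 0) (hsha : (kernelDatum hb₃ hd₃).torsorClass hu ∈ (cpCurve a₃ b₃).sha)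
    {x : 𝓞 K3} {r : K3} (hr : r ≠ 0) (hux : u = (x : K3) * r ^ 3)
    (w₀ : HeightOneSpectrum (𝓞 K3)) (hw₀3 : (3 : 𝓞 K3) ∉ w₀.asIdeal) (hw₀2 : w₀.valuation K3 2 = 1)
    (hw₀s : w₀.valuation K3 s₃ = 1) (hw₀D : w₀.valuation K3 (27 * s₃ - 4 * m₃ ^ 3) < 1) :
    ∃ y : 𝓞 K3, x - y ^ 3 ∈ w₀.asIdeal := by
  set L := w₀.adicCompletion K3 with hL
  set φ := algebraMap K3 L with hφ
  have hvalL : ∀ z : K3, Valued.v (φ z) = w₀.valuation K3 z := fun z => valuedAdicCompletion_eq_valuation' w₀ z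
  obtain ⟨P, w', e, hw', hP⟩ :=
    exists_descent_pow_eq_adicCompletion_of_torsorClass_mem_sha hb₃ hd₃ ht hm₃ hs₃ hu hsha w₀
  have h3' : w₀.valuation K3 (3 : K3) = 1 := by
    have h33 : ((3 : 𝓞 K3) : K3) = 3 := by simpa using coe_natCast_ringOfIntegers 3
    rw [← h33]; exact K3.valuation_coe_eq_one w₀ hw₀3
  have h2L : Valued.v (2 : L) = 1 := by rw [← map_ofNat φ 2, hvalL]; exact hw₀2
  have h3L : Valued.v (3 : L) = 1 := by rw [← map_ofNat φ 3, hvalL]; exact h3'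
  have hsL : Valued.v (φ s₃) = 1 := by rw [hvalL]; exact hw₀s
  have hDL : Valued.v (27 * φ s₃ - 4 * φ m₃ ^ 3) < 1 := by
    rw [show (27 : L) * φ s₃ - 4 * φ m₃ ^ 3 = φ (27 * s₃ - 4 * m₃ ^ 3) by
      rw [map_sub, map_mul, map_mul, map_pow, map_ofNat, map_ofNat], hvalL]
    exact hw₀D
  obtain ⟨c, ε, -, hε, huc⟩ := (Valued.v : Valuation L ℤᵐ⁰).eq_cube_mul_one_add_of_threeTorsionDescent_pow_eq
    (W := threeTorsionModel (φ m₃) (φ s₃)) rfl h2L h3L hsL hDL hw' hP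
  have hr' : φ r ≠ 0 := (map_ne_zero φ).mpr hr
  have hxL : φ (x : K3) = (c / φ r) ^ 3 * (1 + ε) := by
    rw [hux, map_mul, map_pow] at huc
    rw [div_pow, div_mul_eq_mul_div, eq_div_iff (pow_ne_zero 3 hr')]
    linear_combination huc
  exact exists_sub_pow_three_mem_of_eq_cube_mul w₀ hε hxL

/-- **The residue relation from two certificates**: if `ζ^i g₁^{k₁} g₂^{k₂} ≡ y³ (mod w₀)` and `gⱼ ≡ ζ^{cⱼ} yⱼ³ (mod w₀)` with `yⱼ ∉ w₀`,
`3 ∉ w₀`, `9 ∤ N(w₀) − 1`, then `3 ∣ i + c₁k₁ + c₂k₂`. [cite: IrelandRosen1990, Ch. 9 §3] -/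
theorem three_dvd_exponent_of_certs {w₀ : HeightOneSpectrum (𝓞 K3)} (hw₀3 : (3 : 𝓞 K3) ∉ w₀.asIdeal)
    (hw₀9 : ¬ 9 ∣ Ideal.absNorm w₀.asIdeal - 1) {g₁ g₂ y₁ y₂ y : 𝓞 K3} {c₁ c₂ i k₁ k₂ : ℕ}
    (hcert₁ : g₁ - zetaInt ^ c₁ * y₁ ^ 3 ∈ w₀.asIdeal) (hcert₂ : g₂ - zetaInt ^ c₂ * y₂ ^ 3 ∈ w₀.asIdeal)
    (hy₁ : y₁ ∉ w₀.asIdeal) (hy₂ : y₂ ∉ w₀.asIdeal)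
    (hy : zetaInt ^ i * g₁ ^ k₁ * g₂ ^ k₂ - y ^ 3 ∈ w₀.asIdeal) : 3 ∣ i + c₁ * k₁ + c₂ * k₂ := by
  have hrel : zetaInt ^ (i + c₁ * k₁ + c₂ * k₂) * (y₁ ^ k₁ * y₂ ^ k₂) ^ 3 - y ^ 3 ∈ w₀.asIdeal := by
    rw [← Ideal.Quotient.eq]
    set π := Ideal.Quotient.mk w₀.asIdeal with hπ
    have h1 : π g₁ = π zetaInt ^ c₁ * π y₁ ^ 3 := by
      have := (Ideal.Quotient.eq (I := w₀.asIdeal)).mpr hcert₁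
      simpa [map_mul, map_pow] using this
    have h2 : π g₂ = π zetaInt ^ c₂ * π y₂ ^ 3 := by
      have := (Ideal.Quotient.eq (I := w₀.asIdeal)).mpr hcert₂
      simpa [map_mul, map_pow] using this
    have h3 : π (zetaInt ^ i * g₁ ^ k₁ * g₂ ^ k₂) = π y ^ 3 := by
      have := (Ideal.Quotient.eq (I := w₀.asIdeal)).mpr hy
      simpa [map_pow] using this
    rw [map_mul, map_mul, map_pow, map_pow, map_pow, h1, h2] at h3
    rw [map_pow, map_mul, map_pow, map_pow, map_mul, map_pow, map_pow, ← h3]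
    ring
  have ht12 : y₁ ^ k₁ * y₂ ^ k₂ ∉ w₀.asIdeal := by
    intro h
    rcases w₀.isPrime.mem_or_mem h with h | h
    · exact hy₁ (w₀.isPrime.mem_of_pow_mem _ h)
    · exact hy₂ (w₀.isPrime.mem_of_pow_mem _ h)
  exact three_dvd_of_zetaInt_pow_mul_cube_sub_cube_mem hw₀3 hw₀9 ht12 hrel

/-- `3 ∉ w` and `p ∉ w` from `3Np ∉ w` (bookkeeping, private). [cite: CohenPazuki2009, Theorem 2.1 (2)] -/
private theorem not_mem_of_not_mem_mul {N p : ℕ} {w : HeightOneSpectrum (𝓞 K3)} (hw : ((3 * N * p : ℕ) : 𝓞 K3) ∉ w.asIdeal) :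
    (3 : 𝓞 K3) ∉ w.asIdeal ∧ ((p : ℕ) : 𝓞 K3) ∉ w.asIdeal :=
  ⟨fun h => hw (by rw [Nat.cast_mul, Nat.cast_mul, Nat.cast_ofNat, mul_assoc]; exact w.asIdeal.mul_mem_right _ h),
    fun h => hw (by rw [Nat.cast_mul]; exact w.asIdeal.mul_mem_left _ h)⟩

/-! ## One split prime, two killing places: the box dies -/

/-- **The `α̂`-box over `K3` with one split prime and TWO killing places with independent certificates is EMPTY.** For a Cohen–Pazuki pair over
`K3` with inert `N`, split `p = ϖϖ̄`, the valuation conditions off `3Np`, and two node places `w₀, w₁ ∌ 3Np` (`w(2) = w(s₃) = 1 > w(27s₃ − 4m₃³)`,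
`9 ∤ N(w) − 1`) with certificates `ϖϖ̄² ≡ ζ^{c₀} y₀³ (mod w₀)`, `ϖϖ̄² ≡ ζ^{c₀'} y₀'³ (mod w₁)`, `c₀ ≢ c₀' (mod 3)`: every `μ₃`-torsor class `[C_u]`,
`u` of cube norm, lying in `Ш(V₃/K3)` vanishes — with NO generator. [cite: CohenPazuki2009, Theorem 2.1 and Proposition 2.2] -/
theorem torsorClass_eq_zero_of_mem_sha_of_norm_cube_of_split_doubleKill {N : ℕ} (hN0 : N ≠ 0)
    (hN : ∀ q ∈ N.primeFactors, q = 2 ∨ q % 3 = 2) {p : ℕ} (hp : p.Prime) (hp1 : p % 3 = 1) {a b : ℤ}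
    (hab : a ^ 2 - a * b + b ^ 2 = p) {a₃ b₃ t m₃ s₃ : K3} (hb₃ : b₃ ≠ 0)
    (hd₃ : 4 * a₃ ^ 3 + 9 * b₃ ≠ 0) (ht : t ≠ 0) (hm₃ : t * m₃ = 3 * a₃) (hs₃ : t ^ 3 * s₃ = 4 * a₃ ^ 3 + 9 * b₃)
    (hvs : ∀ w : HeightOneSpectrum (𝓞 K3), ((3 * N * p : ℕ) : 𝓞 K3) ∉ w.asIdeal → w.valuation K3 (2 * s₃) = 1)
    (hvm : ∀ w : HeightOneSpectrum (𝓞 K3), ((3 * N * p : ℕ) : 𝓞 K3) ∉ w.asIdeal → w.valuation K3 (2 * m₃) ≤ 1)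
    (w₀ : HeightOneSpectrum (𝓞 K3)) (hw₀ : ((3 * N * p : ℕ) : 𝓞 K3) ∉ w₀.asIdeal) (hw₀2 : w₀.valuation K3 2 = 1)
    (hw₀s : w₀.valuation K3 s₃ = 1) (hw₀D : w₀.valuation K3 (27 * s₃ - 4 * m₃ ^ 3) < 1)
    (hw₀9 : ¬ 9 ∣ Ideal.absNorm w₀.asIdeal - 1)
    {c₀ : ℕ} {y₀ : 𝓞 K3} (hcert : mkInt a b * mkInt (a - b) (-b) ^ 2 - zetaInt ^ c₀ * y₀ ^ 3 ∈ w₀.asIdeal)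
    (w₁ : HeightOneSpectrum (𝓞 K3)) (hw₁ : ((3 * N * p : ℕ) : 𝓞 K3) ∉ w₁.asIdeal) (hw₁2 : w₁.valuation K3 2 = 1)
    (hw₁s : w₁.valuation K3 s₃ = 1) (hw₁D : w₁.valuation K3 (27 * s₃ - 4 * m₃ ^ 3) < 1)
    (hw₁9 : ¬ 9 ∣ Ideal.absNorm w₁.asIdeal - 1)
    {c₀' : ℕ} {y₀' : 𝓞 K3} (hcert' : mkInt a b * mkInt (a - b) (-b) ^ 2 - zetaInt ^ c₀' * y₀' ^ 3 ∈ w₁.asIdeal)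
    (hind : c₀ % 3 ≠ c₀' % 3)
    {u : K3} (hu : u ≠ 0) (hsha : (kernelDatum hb₃ hd₃).torsorClass hu ∈ (cpCurve a₃ b₃).sha)
    (hnorm : ∃ r : ℚ, QuadraticAlgebra.norm u = r ^ 3) : (kernelDatum hb₃ hd₃).torsorClass hu = 0 := by
  set G := Subgroup.closure (Set.range
      fun P : (threeTorsionModel m₃ s₃).toAffine.Point => descentClass (threeTorsionModel m₃ s₃) m₃ s₃ P) with hG
  have hval : ∀ w : HeightOneSpectrum (𝓞 K3), ((3 * N * p : ℕ) : 𝓞 K3) ∉ w.asIdeal →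
      (3 : ℤ) ∣ log (w.valuation K3 u) := by
    intro w hw
    obtain ⟨P, w', e, hw', hP⟩ :=
      exists_descent_pow_eq_adicCompletion_of_torsorClass_mem_sha hb₃ hd₃ ht hm₃ hs₃ hu hsha w
    have hval' : ∀ x : K3, Valued.v (algebraMap K3 (w.adicCompletion K3) x) = w.valuation K3 x :=
      fun x => valuedAdicCompletion_eq_valuation' w x
    have key := Carrier6137.three_dvd_log_of_descent_pow_eq' Valued.v (algebraMap K3 (w.adicCompletion K3))
      (by rw [hval']; exact hvs w hw) (by rw [hval']; exact hvm w hw) hu hw' hP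
    rwa [hval'] at key
  obtain ⟨i, k, l, -, -, -, hkl, hi⟩ := K3.exists_cubeClass_eq_of_norm_cube_split hN0 hN hp hp1 hab hu hval hnorm
  have hz : (zeta : K3) ≠ 0 := isPrimitiveRoot_zeta.ne_zero (by norm_num)
  have hp0 : (p : ℤ) ≠ 0 := by exact_mod_cast hp.ne_zero
  have hϖ : (⟨a, b⟩ : K3) ≠ 0 := fun h0 => by
    have ha : (a : ℚ) = 0 := congrArg QuadraticAlgebra.re h0
    have hb : (b : ℚ) = 0 := congrArg QuadraticAlgebra.im h0
    have ha' : a = 0 := by exact_mod_cast ha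
    have hb' : b = 0 := by exact_mod_cast hb
    subst ha'; subst hb'
    exact hp0 (by rw [← hab]; ring)
  have hϖ' : (⟨a - b, -b⟩ : K3) ≠ 0 := fun h0 => by
    have ha : (a : ℚ) - b = 0 := congrArg QuadraticAlgebra.re h0
    have hb : -(b : ℚ) = 0 := congrArg QuadraticAlgebra.im h0
    have hb' : b = 0 := by exact_mod_cast (neg_eq_zero.mp hb)
    subst hb'
    have ha' : a = 0 := by exact_mod_cast (show (a : ℚ) = 0 by simpa using ha)
    subst ha'
    exact hp0 (by rw [← hab]; ring)
  have hg : (⟨a, b⟩ : K3) * (⟨a - b, -b⟩ : K3) ^ 2 ≠ 0 := mul_ne_zero hϖ (pow_ne_zero _ hϖ')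
  -- `g`-form: `[u] = [ζ^i (ϖϖ̄²)^k]`
  have hi' : cubeClass u = cubeClass ((zeta : K3) ^ i * ((⟨a, b⟩ : K3) * (⟨a - b, -b⟩ : K3) ^ 2) ^ k) := by
    rw [hi]; exact K3.cubeClass_mul_varpi_pow_eq hϖ hϖ' (pow_ne_zero _ hz) hkl
  have hmon : (zeta : K3) ^ i * ((⟨a, b⟩ : K3) * (⟨a - b, -b⟩ : K3) ^ 2) ^ k ≠ 0 := mul_ne_zero (pow_ne_zero _ hz) (pow_ne_zero _ hg)
  obtain ⟨r, hr, hur⟩ := (cubeClass_eq_cubeClass_iff hu hmon).mp hi'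
  set gInt : 𝓞 K3 := mkInt a b * mkInt (a - b) (-b) ^ 2 with hgdef
  set xInt : 𝓞 K3 := zetaInt ^ i * gInt ^ k * gInt ^ 0 with hxdef
  have hxInt' : ((mkInt (a - b) (-b) : 𝓞 K3) : K3) = (⟨a - b, -b⟩ : K3) := by rw [coe_mkInt]; push_cast; rfl
  have hxK : (xInt : K3) = (zeta : K3) ^ i * ((⟨a, b⟩ : K3) * (⟨a - b, -b⟩ : K3) ^ 2) ^ k := by
    rw [hxdef, hgdef]; push_cast [coe_zetaInt, coe_mkInt, hxInt']; ring
  have hux : u = (xInt : K3) * r ^ 3 := by rw [hxK]; exact hur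
  -- the two relations
  obtain ⟨hw₀3, hw₀p⟩ := not_mem_of_not_mem_mul hw₀
  obtain ⟨hw₁3, hw₁p⟩ := not_mem_of_not_mem_mul hw₁
  obtain ⟨y, hy⟩ := exists_sub_pow_three_mem_of_sha_nodePlace hb₃ hd₃ ht hm₃ hs₃ hu hsha hr hux w₀ hw₀3 hw₀2 hw₀s hw₀D
  obtain ⟨y', hy'⟩ := exists_sub_pow_three_mem_of_sha_nodePlace hb₃ hd₃ ht hm₃ hs₃ hu hsha hr hux w₁ hw₁3 hw₁2 hw₁s hw₁D
  have hrel₀ : 3 ∣ i + c₀ * k + c₀ * 0 := three_dvd_exponent_of_certs hw₀3 hw₀9 hcert hcert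
    (cert_root_not_mem hab hw₀p hcert) (cert_root_not_mem hab hw₀p hcert) (by rw [hxdef] at hy; exact hy)
  have hrel₁ : 3 ∣ i + c₀' * k + c₀' * 0 := three_dvd_exponent_of_certs hw₁3 hw₁9 hcert' hcert'
    (cert_root_not_mem hab hw₁p hcert') (cert_root_not_mem hab hw₁p hcert') (by rw [hxdef] at hy'; exact hy')
  -- independence forces `k = 0`, then `3 ∣ i`: the class is trivial
  have hk3 : k < 3 := by rcases hkl with ⟨rfl, -⟩ | ⟨rfl, -⟩ | ⟨rfl, -⟩ <;> norm_num
  have hk0 : k = 0 := by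
    interval_cases k
    · rfl
    · exfalso; apply hind; omega
    · exfalso; apply hind; omega
  subst hk0
  have h3i : 3 ∣ i := by simpa using hrel₀
  obtain ⟨d, rfl⟩ := h3i
  rw [(kernelDatum hb₃ hd₃).torsorClass_eq_zero_iff_cubeClass_mem_ker hu, hi', MonoidHom.mem_ker]
  refine torsorClassQuotHom_eq_one_of_mem_closure hb₃ hd₃ ht hm₃ hs₃ ?_
  rw [pow_zero, mul_one, pow_mul, isPrimitiveRoot_zeta.pow_eq_one, one_pow, cubeClass_one]
  exact G.one_mem

/-! ## Two split primes, two killing places: one generator -/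

/-- `[z^a g₁^b g₂^c]` depends only on the exponents mod `3` (bookkeeping). [cite: CohenPazuki2009, Def. 1.3] -/
theorem cubeClass_monomial_eq_mod {z g₁ g₂ : K3} (hz : z ≠ 0) (hg₁ : g₁ ≠ 0) (hg₂ : g₂ ≠ 0) (a b c : ℕ) :
    cubeClass (z ^ a * g₁ ^ b * g₂ ^ c) = cubeClass (z ^ (a % 3) * g₁ ^ (b % 3) * g₂ ^ (c % 3)) := by
  have split : ∀ (x : K3) (n : ℕ), x ^ n = x ^ (n % 3) * (x ^ (n / 3)) ^ 3 := fun x n => by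
    rw [← pow_mul, ← pow_add, Nat.mod_add_div']
  have hX : z ^ (a % 3) * g₁ ^ (b % 3) * g₂ ^ (c % 3) ≠ 0 :=
    mul_ne_zero (mul_ne_zero (pow_ne_zero _ hz) (pow_ne_zero _ hg₁)) (pow_ne_zero _ hg₂)
  rw [split z a, split g₁ b, split g₂ c,
    show z ^ (a % 3) * (z ^ (a / 3)) ^ 3 * (g₁ ^ (b % 3) * (g₁ ^ (b / 3)) ^ 3) * (g₂ ^ (c % 3) * (g₂ ^ (c / 3)) ^ 3) =
      z ^ (a % 3) * g₁ ^ (b % 3) * g₂ ^ (c % 3) * (z ^ (a / 3) * g₁ ^ (b / 3) * g₂ ^ (c / 3)) ^ 3 by ring,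
    cubeClass_mul_pow_three hX (mul_ne_zero (mul_ne_zero (pow_ne_zero _ hz) (pow_ne_zero _ hg₁)) (pow_ne_zero _ hg₂))]

/-- `3Np₁p₂ ∉ w ⟹ 3, p₁, p₂ ∉ w` (bookkeeping, private). [cite: CohenPazuki2009, Theorem 2.1 (2)] -/
private theorem not_mem_of_not_mem_mul₂ {N p₁ p₂ : ℕ} {w : HeightOneSpectrum (𝓞 K3)}
    (hw : ((3 * N * p₁ * p₂ : ℕ) : 𝓞 K3) ∉ w.asIdeal) :
    (3 : 𝓞 K3) ∉ w.asIdeal ∧ ((p₁ : ℕ) : 𝓞 K3) ∉ w.asIdeal ∧ ((p₂ : ℕ) : 𝓞 K3) ∉ w.asIdeal :=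
  ⟨fun h => hw (by
      rw [Nat.cast_mul, Nat.cast_mul, Nat.cast_mul, Nat.cast_ofNat, mul_assoc, mul_assoc]
      exact w.asIdeal.mul_mem_right _ h),
    fun h => hw (by
      rw [Nat.cast_mul, Nat.cast_mul]; exact w.asIdeal.mul_mem_right _ (w.asIdeal.mul_mem_left _ h)),
    fun h => hw (by rw [Nat.cast_mul]; exact w.asIdeal.mul_mem_left _ h)⟩

/-- **The `α̂`-box over `K3` with two split primes and TWO killing places: ONE generator.** For a Cohen–Pazuki pair over `K3` with inert `N`,
split `p₁ ≠ p₂`, the valuation conditions off `3Np₁p₂`, two node places `w₀, w₁ ∌ 3Np₁p₂` with certificates `ϖⱼϖ̄ⱼ² ≡ ζ^{cⱼ} yⱼ³ (mod w₀)`,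
`ϖⱼϖ̄ⱼ² ≡ ζ^{cⱼ'} yⱼ'³ (mod w₁)`, a SURVIVOR TABLE `hsurv` (the solutions `(k₁, k₂) ∈ 𝔽₃²` of the difference relation
`(c₁ − c₁')k₁ + (c₂ − c₂')k₂ ≡ 0` are the multiples of `(e₁, e₂)` — a finite check per curve), and ONE descent class
`[ζ^{e₀} (ϖ₁ϖ̄₁²)^{e₁} (ϖ₂ϖ̄₂²)^{e₂}] ∈ G` satisfying the relation at `w₀`: every `μ₃`-torsor class `[C_u]`, `u` of cube norm, lying in
`Ш(V₃/K3)` vanishes. [cite: CohenPazuki2009, Theorem 2.1 and Proposition 2.2] -/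
theorem torsorClass_eq_zero_of_mem_sha_of_norm_cube_of_split₂_doubleKill {N : ℕ} (hN0 : N ≠ 0)
    (hN : ∀ q ∈ N.primeFactors, q = 2 ∨ q % 3 = 2) {p₁ : ℕ} (hp₁ : p₁.Prime) (hp₁1 : p₁ % 3 = 1) {a₁ b₁ : ℤ}
    (hab₁ : a₁ ^ 2 - a₁ * b₁ + b₁ ^ 2 = p₁) {p₂ : ℕ} (hp₂ : p₂.Prime) (hp₂1 : p₂ % 3 = 1) {a₂ b₂ : ℤ}
    (hab₂ : a₂ ^ 2 - a₂ * b₂ + b₂ ^ 2 = p₂) (hne : p₁ ≠ p₂) {a₃ b₃ t m₃ s₃ : K3} (hb₃ : b₃ ≠ 0)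
    (hd₃ : 4 * a₃ ^ 3 + 9 * b₃ ≠ 0) (ht : t ≠ 0) (hm₃ : t * m₃ = 3 * a₃) (hs₃ : t ^ 3 * s₃ = 4 * a₃ ^ 3 + 9 * b₃)
    (hvs : ∀ w : HeightOneSpectrum (𝓞 K3), ((3 * N * p₁ * p₂ : ℕ) : 𝓞 K3) ∉ w.asIdeal → w.valuation K3 (2 * s₃) = 1)
    (hvm : ∀ w : HeightOneSpectrum (𝓞 K3), ((3 * N * p₁ * p₂ : ℕ) : 𝓞 K3) ∉ w.asIdeal → w.valuation K3 (2 * m₃) ≤ 1)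
    (w₀ : HeightOneSpectrum (𝓞 K3)) (hw₀ : ((3 * N * p₁ * p₂ : ℕ) : 𝓞 K3) ∉ w₀.asIdeal) (hw₀2 : w₀.valuation K3 2 = 1)
    (hw₀s : w₀.valuation K3 s₃ = 1) (hw₀D : w₀.valuation K3 (27 * s₃ - 4 * m₃ ^ 3) < 1)
    (hw₀9 : ¬ 9 ∣ Ideal.absNorm w₀.asIdeal - 1)
    {c₁ c₂ : ℕ} {y₁ y₂ : 𝓞 K3} (hcert₁ : mkInt a₁ b₁ * mkInt (a₁ - b₁) (-b₁) ^ 2 - zetaInt ^ c₁ * y₁ ^ 3 ∈ w₀.asIdeal)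
    (hcert₂ : mkInt a₂ b₂ * mkInt (a₂ - b₂) (-b₂) ^ 2 - zetaInt ^ c₂ * y₂ ^ 3 ∈ w₀.asIdeal)
    (w₁ : HeightOneSpectrum (𝓞 K3)) (hw₁ : ((3 * N * p₁ * p₂ : ℕ) : 𝓞 K3) ∉ w₁.asIdeal) (hw₁2 : w₁.valuation K3 2 = 1)
    (hw₁s : w₁.valuation K3 s₃ = 1) (hw₁D : w₁.valuation K3 (27 * s₃ - 4 * m₃ ^ 3) < 1)
    (hw₁9 : ¬ 9 ∣ Ideal.absNorm w₁.asIdeal - 1)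
    {c₁' c₂' : ℕ} {y₁' y₂' : 𝓞 K3} (hcert₁' : mkInt a₁ b₁ * mkInt (a₁ - b₁) (-b₁) ^ 2 - zetaInt ^ c₁' * y₁' ^ 3 ∈ w₁.asIdeal)
    (hcert₂' : mkInt a₂ b₂ * mkInt (a₂ - b₂) (-b₂) ^ 2 - zetaInt ^ c₂' * y₂' ^ 3 ∈ w₁.asIdeal)
    {e₀ e₁ e₂ : ℕ} (hv₀ : 3 ∣ e₀ + c₁ * e₁ + c₂ * e₂)
    (hsurv : ∀ k₁ k₂ : ℕ, k₁ < 3 → k₂ < 3 → 3 ∣ (c₁ + 2 * c₁') * k₁ + (c₂ + 2 * c₂') * k₂ →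
      (k₁ = 0 ∧ k₂ = 0) ∨ (k₁ = e₁ ∧ k₂ = e₂) ∨ (k₁ = (2 * e₁) % 3 ∧ k₂ = (2 * e₂) % 3))
    (hgen : cubeClass ((zeta : K3) ^ e₀ * ((⟨a₁, b₁⟩ : K3) * (⟨a₁ - b₁, -b₁⟩ : K3) ^ 2) ^ e₁ *
        ((⟨a₂, b₂⟩ : K3) * (⟨a₂ - b₂, -b₂⟩ : K3) ^ 2) ^ e₂) ∈ Subgroup.closure (Set.range
        fun P : (threeTorsionModel m₃ s₃).toAffine.Point => descentClass (threeTorsionModel m₃ s₃) m₃ s₃ P))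
    {u : K3} (hu : u ≠ 0) (hsha : (kernelDatum hb₃ hd₃).torsorClass hu ∈ (cpCurve a₃ b₃).sha)
    (hnorm : ∃ r : ℚ, QuadraticAlgebra.norm u = r ^ 3) : (kernelDatum hb₃ hd₃).torsorClass hu = 0 := by
  set G := Subgroup.closure (Set.range
      fun P : (threeTorsionModel m₃ s₃).toAffine.Point => descentClass (threeTorsionModel m₃ s₃) m₃ s₃ P) with hG
  have hval : ∀ w : HeightOneSpectrum (𝓞 K3), ((3 * N * p₁ * p₂ : ℕ) : 𝓞 K3) ∉ w.asIdeal →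
      (3 : ℤ) ∣ log (w.valuation K3 u) := by
    intro w hw
    obtain ⟨P, w', e, hw', hP⟩ :=
      exists_descent_pow_eq_adicCompletion_of_torsorClass_mem_sha hb₃ hd₃ ht hm₃ hs₃ hu hsha w
    have hval' : ∀ x : K3, Valued.v (algebraMap K3 (w.adicCompletion K3) x) = w.valuation K3 x :=
      fun x => valuedAdicCompletion_eq_valuation' w x
    have key := Carrier6137.three_dvd_log_of_descent_pow_eq' Valued.v (algebraMap K3 (w.adicCompletion K3))
      (by rw [hval']; exact hvs w hw) (by rw [hval']; exact hvm w hw) hu hw' hP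
    rwa [hval'] at key
  obtain ⟨i, k₁, k₂, -, hk₁, hk₂, hi⟩ :=
    K3.exists_cubeClass_eq_of_norm_cube_split₂ hN0 hN hp₁ hp₁1 hab₁ hp₂ hp₂1 hab₂ hne hu hval hnorm
  have hz : (zeta : K3) ≠ 0 := isPrimitiveRoot_zeta.ne_zero (by norm_num)
  have hϖne : ∀ {p : ℕ} (_ : p.Prime) {a b : ℤ} (_ : a ^ 2 - a * b + b ^ 2 = p), (⟨a, b⟩ : K3) ≠ 0 := by
    intro p hp a b hab h0
    have hp0 : (p : ℤ) ≠ 0 := by exact_mod_cast hp.ne_zero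
    have ha : (a : ℚ) = 0 := congrArg QuadraticAlgebra.re h0
    have hb : (b : ℚ) = 0 := congrArg QuadraticAlgebra.im h0
    have ha' : a = 0 := by exact_mod_cast ha
    have hb' : b = 0 := by exact_mod_cast hb
    subst ha'; subst hb'
    exact hp0 (by rw [← hab]; ring)
  have hϖ₁ := hϖne hp₁ hab₁
  have hϖ₁' : (⟨a₁ - b₁, -b₁⟩ : K3) ≠ 0 := by
    have h := hϖne hp₁ ((norm_conj_eq a₁ b₁).trans hab₁)
    intro h0; apply h
    have e : (⟨((a₁ - b₁ : ℤ) : ℚ), ((-b₁ : ℤ) : ℚ)⟩ : K3) = ⟨(a₁ : ℚ) - b₁, -b₁⟩ := by push_cast; rfl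
    rw [e]; exact h0
  have hϖ₂ := hϖne hp₂ hab₂
  have hϖ₂' : (⟨a₂ - b₂, -b₂⟩ : K3) ≠ 0 := by
    have h := hϖne hp₂ ((norm_conj_eq a₂ b₂).trans hab₂)
    intro h0; apply h
    have e : (⟨((a₂ - b₂ : ℤ) : ℚ), ((-b₂ : ℤ) : ℚ)⟩ : K3) = ⟨(a₂ : ℚ) - b₂, -b₂⟩ := by push_cast; rfl
    rw [e]; exact h0
  have hg₁ : (⟨a₁, b₁⟩ : K3) * (⟨a₁ - b₁, -b₁⟩ : K3) ^ 2 ≠ 0 := mul_ne_zero hϖ₁ (pow_ne_zero _ hϖ₁')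
  have hg₂ : (⟨a₂, b₂⟩ : K3) * (⟨a₂ - b₂, -b₂⟩ : K3) ^ 2 ≠ 0 := mul_ne_zero hϖ₂ (pow_ne_zero _ hϖ₂')
  have hmon : (zeta : K3) ^ i * ((⟨a₁, b₁⟩ : K3) * (⟨a₁ - b₁, -b₁⟩ : K3) ^ 2) ^ k₁ *
      ((⟨a₂, b₂⟩ : K3) * (⟨a₂ - b₂, -b₂⟩ : K3) ^ 2) ^ k₂ ≠ 0 :=
    mul_ne_zero (mul_ne_zero (pow_ne_zero i hz) (pow_ne_zero _ hg₁)) (pow_ne_zero _ hg₂)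
  obtain ⟨r, hr, hur⟩ := (cubeClass_eq_cubeClass_iff hu hmon).mp hi
  set g₁Int : 𝓞 K3 := mkInt a₁ b₁ * mkInt (a₁ - b₁) (-b₁) ^ 2 with hg₁def
  set g₂Int : 𝓞 K3 := mkInt a₂ b₂ * mkInt (a₂ - b₂) (-b₂) ^ 2 with hg₂def
  set xInt : 𝓞 K3 := zetaInt ^ i * g₁Int ^ k₁ * g₂Int ^ k₂ with hxdef
  have hxInt₁' : ((mkInt (a₁ - b₁) (-b₁) : 𝓞 K3) : K3) = (⟨a₁ - b₁, -b₁⟩ : K3) := by rw [coe_mkInt]; push_cast; rfl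
  have hxInt₂' : ((mkInt (a₂ - b₂) (-b₂) : 𝓞 K3) : K3) = (⟨a₂ - b₂, -b₂⟩ : K3) := by rw [coe_mkInt]; push_cast; rfl
  have hxK : (xInt : K3) = (zeta : K3) ^ i * ((⟨a₁, b₁⟩ : K3) * (⟨a₁ - b₁, -b₁⟩ : K3) ^ 2) ^ k₁ *
      ((⟨a₂, b₂⟩ : K3) * (⟨a₂ - b₂, -b₂⟩ : K3) ^ 2) ^ k₂ := by
    rw [hxdef, hg₁def, hg₂def]; push_cast [coe_zetaInt, coe_mkInt, hxInt₁', hxInt₂']; ring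
  have hux : u = (xInt : K3) * r ^ 3 := by rw [hxK]; exact hur
  obtain ⟨hw₀3, hw₀p₁, hw₀p₂⟩ := not_mem_of_not_mem_mul₂ hw₀
  obtain ⟨hw₁3, hw₁p₁, hw₁p₂⟩ := not_mem_of_not_mem_mul₂ hw₁
  obtain ⟨y, hy⟩ := exists_sub_pow_three_mem_of_sha_nodePlace hb₃ hd₃ ht hm₃ hs₃ hu hsha hr hux w₀ hw₀3 hw₀2 hw₀s hw₀D
  obtain ⟨y', hy'⟩ := exists_sub_pow_three_mem_of_sha_nodePlace hb₃ hd₃ ht hm₃ hs₃ hu hsha hr hux w₁ hw₁3 hw₁2 hw₁s hw₁D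
  have hrel₀ : 3 ∣ i + c₁ * k₁ + c₂ * k₂ := three_dvd_exponent_of_certs hw₀3 hw₀9 hcert₁ hcert₂
    (cert_root_not_mem hab₁ hw₀p₁ hcert₁) (cert_root_not_mem hab₂ hw₀p₂ hcert₂) (by rw [hxdef] at hy; exact hy)
  have hrel₁ : 3 ∣ i + c₁' * k₁ + c₂' * k₂ := three_dvd_exponent_of_certs hw₁3 hw₁9 hcert₁' hcert₂'
    (cert_root_not_mem hab₁ hw₁p₁ hcert₁') (cert_root_not_mem hab₂ hw₁p₂ hcert₂') (by rw [hxdef] at hy'; exact hy')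
  -- the survivor `(k₁, k₂)` is a multiple `λ·(e₁, e₂)`, and then `i ≡ λ e₀ (mod 3)` (read in `ZMod 3`)
  have hD : 3 ∣ (c₁ + 2 * c₁') * k₁ + (c₂ + 2 * c₂') * k₂ := by
    have h := Nat.dvd_add hrel₀ (Dvd.dvd.mul_left hrel₁ 2)
    have e : i + c₁ * k₁ + c₂ * k₂ + 2 * (i + c₁' * k₁ + c₂' * k₂) =
        3 * i + ((c₁ + 2 * c₁') * k₁ + (c₂ + 2 * c₂') * k₂) := by ring
    rw [e] at h
    exact (Nat.dvd_add_right (dvd_mul_right 3 i)).mp h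
  have z0 : (i : ZMod 3) + c₁ * k₁ + c₂ * k₂ = 0 := by
    have := (ZMod.natCast_eq_zero_iff _ 3).mpr hrel₀
    push_cast at this
    exact this
  have zv : (e₀ : ZMod 3) + c₁ * e₁ + c₂ * e₂ = 0 := by
    have := (ZMod.natCast_eq_zero_iff _ 3).mpr hv₀
    push_cast at this
    exact this
  have hmod := cubeClass_monomial_eq_mod hz hg₁ hg₂
  set V := (zeta : K3) ^ e₀ * ((⟨a₁, b₁⟩ : K3) * (⟨a₁ - b₁, -b₁⟩ : K3) ^ 2) ^ e₁ *
      ((⟨a₂, b₂⟩ : K3) * (⟨a₂ - b₂, -b₂⟩ : K3) ^ 2) ^ e₂ with hV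
  rw [(kernelDatum hb₃ hd₃).torsorClass_eq_zero_iff_cubeClass_mem_ker hu, hi, MonoidHom.mem_ker]
  refine torsorClassQuotHom_eq_one_of_mem_closure hb₃ hd₃ ht hm₃ hs₃ ?_
  rcases hsurv k₁ k₂ hk₁ hk₂ hD with ⟨rfl, rfl⟩ | ⟨hk1, hk2⟩ | ⟨hk1, hk2⟩
  · have hi0 : i % 3 = 0 % 3 := by
      refine (ZMod.natCast_eq_natCast_iff' i 0 3).mp ?_
      push_cast
      linear_combination z0
    rw [hmod i 0 0, hi0, Nat.zero_mod, pow_zero, pow_zero, pow_zero, mul_one, mul_one, cubeClass_one]; exact G.one_mem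
  · subst hk1; subst hk2
    have hi1 : i % 3 = e₀ % 3 := by
      refine (ZMod.natCast_eq_natCast_iff' i e₀ 3).mp ?_
      linear_combination z0 - zv
    rw [hmod i k₁ k₂, hi1, ← hmod e₀ k₁ k₂]; exact hgen
  · have hk1' : (k₁ : ZMod 3) = 2 * e₁ := by
      rw [hk1, ZMod.natCast_mod]; push_cast; ring
    have hk2' : (k₂ : ZMod 3) = 2 * e₂ := by
      rw [hk2, ZMod.natCast_mod]; push_cast; ring
    have hi2 : i % 3 = (2 * e₀) % 3 := by
      refine (ZMod.natCast_eq_natCast_iff' i (2 * e₀) 3).mp ?_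
      push_cast
      linear_combination z0 - 2 * zv - (c₁ : ZMod 3) * hk1' - (c₂ : ZMod 3) * hk2'
    have hsq : V ^ 2 = (zeta : K3) ^ (2 * e₀) * ((⟨a₁, b₁⟩ : K3) * (⟨a₁ - b₁, -b₁⟩ : K3) ^ 2) ^ (2 * e₁) *
        ((⟨a₂, b₂⟩ : K3) * (⟨a₂ - b₂, -b₂⟩ : K3) ^ 2) ^ (2 * e₂) := by rw [hV]; ring
    have hVne : V ≠ 0 := mul_ne_zero (mul_ne_zero (pow_ne_zero _ hz) (pow_ne_zero _ hg₁)) (pow_ne_zero _ hg₂)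
    rw [hmod i k₁ k₂, hi2, hk1, hk2, Nat.mod_mod, Nat.mod_mod, ← hmod (2 * e₀) (2 * e₁) (2 * e₂), ← hsq,
      pow_two, cubeClass_mul hVne hVne]
    exact G.mul_mem hgen hgen

end CPMuDescent

end Literature.NumberTheory.EllipticCurves

end
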